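import Summits.HodgeConjecture.HodgeConjecture.Theorems.FormalLiftingFromClassLifting.Negative.ProClassCorrectionStubs
import Literature.AlgebraicGeometry.Motives.GrothendieckExistenceWitt
import Literature.AlgebraicGeometry.Modules.VectorBundleFiniteLocallyFree
import Literature.AlgebraicGeometry.Crystalline.BlochEsnaultKerzLifting

/-!
# Route AnchorTransport — crux `VariationalHodge` (stmt-HodgeConjecture-1076), line `padic-disc-transport`:
# STUB P (the bet) holds on EFFECTIVE pro-classes, modulo Grothendieck's existence theorem

HONEST FRAMING: research route conditional on HC_CM; not a corollary; Q11.4-sentence-2 already refuted in dim ≥ 3.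
Helper file on the crux item (nothing here closes it; no definition, no named fact, no `sorry`;
`HC_CM` does not occur). Cell `pub-hodge-ring2`, binder seat `ring2-b03` (gen 39), BINDER-OWNERS row b03.

STUB P of the registered skeleton `Cruxes/VariationalHodge/Lines/padic_disc_transport.lean`
(`PadicDiscTransport.PadicImageAlgebraization`, the research bet of the line: the `K₀`-form of
Antieau–Mathew–Morrow–Nikolaus 2022 Conj. 1.3 = Bloch–Esnault–Kerz 2014 Conj. 1.2) asks, for a smooth
proper model `𝒴/W(κ)` and a rational pro-class `ξ̂ ∈ (lim_n K₀(𝒴 ⊗ W/p^{n+1})) ⊗ ℚ`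
(`KTheory.ContinuousKZeroRat`), that `ξ̂|_{Y_κ}` be the restriction of an algebraic class
`η ∈ K₀(𝒴)_ℚ` (`PadicDiscTransport.ProClassAlgebraizes`, spelled out VERBATIM below — the skeleton's
local `def`s are not importable under `Theorems/`).

This file records, in the kernel and in exactly that vocabulary, the part of the bet that is KNOWN, so
that the open content of P is isolated:

* §1 `proClassAlgebraizes_iff_specialFibre_mem_range` — the conclusion of P for `ξ̂` is a statement
  about the bottom class `ξ̂|_{X_0} ∈ K₀(𝒴 ⊗ W/p)_ℚ` alone (its pull-back to `Y_κ` lies in the range of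
  `K₀(𝒴)_ℚ → K₀(Y_κ)_ℚ`); hence it is `ℚ`-LINEAR in `ξ̂` (`…_zero`, `…_add`, `…_smul`) and holds for
  the algebraic pro-classes `(η|_{X_n})_n` (`…_restrict`; BEK §1, `K₀(X) → lim_n K₀(X_n) → K₀(X₁)`).
* §2 EFFECTIVE pro-classes: a compatible tower `(E_n)_n` of vector bundles on the thickenings
  `𝒴 ⊗ W/p^{n+1}` (`KTheory.thickening (p) 𝒴 n`, isomorphisms `E_{n+1}|_{X_n} ≅ E_n` along
  `KTheory.thickeningTransition`) defines a pro-class `([E_n])_n` (`exists_continuousKZeroRat_of_tower`),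
  and its bottom bundle, read on `Y_κ ≅ 𝒴 ⊗ W/p` (`Crystalline.specialFibreToTower`), LIFTS FORMALLY
  (`WittScheme.LiftsFormally`; `liftsFormally_of_tower` — the tree's two thickening towers
  `KTheory.thickening (p) 𝒴 n` and `WittScheme.thickening 𝒴 (n+1)` are the same schemes,
  `thickeningTransition_eq_thickeningMap` of `Theorems/FormalLiftingFromClassLifting/Negative/`).
* §3 THE RUNG: **P holds for every pro-class whose bottom class is effective** — more generally lies
  in the `ℚ`-span of bottom classes of compatible towers of vector bundles — on every PROPER `𝒴/W(κ)`,
  `κ` perfect, MODULO Grothendieck's existence theorem for vector bundles (the tree's named fact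
  `Motives.GrothendieckExistence_vectorBundle_witt` = Görtz–Wedhorn II Thm. 24.94 / Prop. 24.95 =
  EGA III₁ Thm. 5.1.4, NOT discharged): `proClassAlgebraizes_of_tower_of_grothendieckExistence`,
  `proClassAlgebraizes_of_mem_span_effective_of_grothendieckExistence` — the vector-bundle form of the
  line-bundle case in print (Bloch–Esnault–Kerz 2014 §1 (1.3): "Grothendieck's formal existence theorem
  [EGA3] gives an algebraization isomorphism `Pic(X) ≅ lim_n Pic(X_n)`"). What it isolates as the OPEN
  content of P: pro-classes that are compatible families of VIRTUAL classes not realised (up to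
  `ℚ`-combinations) by compatible families of bundles — BEK §1 Remark (iii): "in order to algebraize
  `ξ̂` … one might have to move it to another pro-class with the same Chern character".
* §4 JUNCTION of routes at STUB P: route `PadicSemiregularLift`'s item `FormalVectorBundlesAlgebraize`
  (stmt-HodgeConjecture-14106: `LiftsFormally ⟹ LiftsTo` on smooth proper models) gives the same
  conclusion (`proClassAlgebraizes_of_tower_of_formalVectorBundlesAlgebraize`), and
  `padicImageAlgebraization_effective_of_formalVectorBundlesAlgebraize` is STUB P VERBATIM with ONE
  extra binder (effectivity of `ξ̂|_{X_0}`), derived from that item — the skeleton's "junction with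
  route `PadicSemiregularLift`, whose engine … `FormalVectorBundlesAlgebraize` is one way to prove
  STUB P" as a kernel edge.

What is NOT claimed: P itself (open); Grothendieck's existence theorem (a named fact, hypothesis
`hGE`); anything about the crux `VariationalHodge` or the Hodge conjecture beyond these implications.

References: [BlochEsnaultKerz2014pAdic] §1 ((1.3), Conj. 1.2, Thm. 1.3, Remark (iii));
[AntieauMathewMorrowNikolaus2022] Conj. 1.3, Question 1.4; [GortzWedhorn2023] Thm. 24.94, Prop. 24.95,
Lemma 24.96; [EGAIII1] Thm. 5.1.4; [Fulton1998] §15.1.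
-/

noncomputable section

-- every declaration of this problem lives in `Summit.HodgeConjecture.HodgeConjecture.…` (summit = sub-problem)
set_option linter.dupNamespace false

open CategoryTheory CategoryTheory.Limits AlgebraicGeometry
open scoped TensorProduct
open Literature.AlgebraicGeometry Literature.AlgebraicGeometry.Motives
open Literature.AlgebraicGeometry.KTheory Literature.AlgebraicGeometry.Crystalline
open Summit.HodgeConjecture.HodgeConjecture.Theorems.FormalLiftingFromClassLifting.Negative
  (thickeningTransition_eq_thickeningMap)

namespace Summit.HodgeConjecture.HodgeConjecture.Theorems

variable {p : ℕ} [Fact p.Prime] {κ : Type} [Field κ] [CharP κ p]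
  (𝒴 : SchemeOver (WittVector p κ))

/-! ## §1 The conclusion of STUB P is a `ℚ`-linear condition on the bottom class `ξ̂|_{X_0}` -/

section Linear
/-- **The conclusion of STUB P (`ProClassAlgebraizes 𝒴 ξ̂`, verbatim) depends only on `ξ̂|_{X_0}`**:
it says that the pull-back of `ξ̂|_{X_0} ∈ K₀(𝒴 ⊗ W/p)_ℚ` to `Y_κ` lies in the range of the
restriction `K₀(𝒴)_ℚ → K₀(Y_κ)_ℚ` (Bloch–Esnault–Kerz 2014 §1: the algebraization question concerns the
composite `K₀(X) → lim_n K₀(X_n) → K₀(X₁)`). [cite: BlochEsnaultKerz2014pAdic, §1 and Conj. 1.2] -/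
theorem proClassAlgebraizes_iff_specialFibre_mem_range
    (ξ : ContinuousKZeroRat (Ideal.span {(p : WittVector p κ)}) 𝒴) :
    (∃ η : KZeroRat 𝒴.left,
        KZeroRat.map (WittScheme.specialFibreι 𝒴) η =
          KZeroRat.map (specialFibreToTower 𝒴)
            (ContinuousKZeroRat.specialFibre (Ideal.span {(p : WittVector p κ)}) 𝒴 ξ)) ↔
      KZeroRat.map (specialFibreToTower 𝒴)
          (ContinuousKZeroRat.specialFibre (Ideal.span {(p : WittVector p κ)}) 𝒴 ξ) ∈
        LinearMap.range (KZeroRat.map (WittScheme.specialFibreι 𝒴)) := by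
  simp only [LinearMap.mem_range]

/-- The conclusion of STUB P holds for `ξ̂ = 0` (with `η = 0`). [folklore] -/
theorem proClassAlgebraizes_zero :
    ∃ η : KZeroRat 𝒴.left,
        KZeroRat.map (WittScheme.specialFibreι 𝒴) η =
          KZeroRat.map (specialFibreToTower 𝒴)
            (ContinuousKZeroRat.specialFibre (Ideal.span {(p : WittVector p κ)}) 𝒴 0) :=
  ⟨0, by rw [map_zero, map_zero, map_zero]⟩

/-- The conclusion of STUB P is stable under sums (add the algebraizations). [folklore] -/
theorem proClassAlgebraizes_add
    {ξ ξ' : ContinuousKZeroRat (Ideal.span {(p : WittVector p κ)}) 𝒴}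
    (hξ : ∃ η : KZeroRat 𝒴.left,
        KZeroRat.map (WittScheme.specialFibreι 𝒴) η =
          KZeroRat.map (specialFibreToTower 𝒴)
            (ContinuousKZeroRat.specialFibre (Ideal.span {(p : WittVector p κ)}) 𝒴 ξ))
    (hξ' : ∃ η : KZeroRat 𝒴.left,
        KZeroRat.map (WittScheme.specialFibreι 𝒴) η =
          KZeroRat.map (specialFibreToTower 𝒴)
            (ContinuousKZeroRat.specialFibre (Ideal.span {(p : WittVector p κ)}) 𝒴 ξ')) :
    ∃ η : KZeroRat 𝒴.left,
        KZeroRat.map (WittScheme.specialFibreι 𝒴) η =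
          KZeroRat.map (specialFibreToTower 𝒴)
            (ContinuousKZeroRat.specialFibre (Ideal.span {(p : WittVector p κ)}) 𝒴 (ξ + ξ')) := by
  obtain ⟨η, hη⟩ := hξ
  obtain ⟨η', hη'⟩ := hξ'
  exact ⟨η + η', by rw [map_add, map_add, map_add, hη, hη']⟩

/-- The conclusion of STUB P is stable under rational multiples. [folklore] -/
theorem proClassAlgebraizes_smul (a : ℚ)
    {ξ : ContinuousKZeroRat (Ideal.span {(p : WittVector p κ)}) 𝒴}
    (hξ : ∃ η : KZeroRat 𝒴.left,
        KZeroRat.map (WittScheme.specialFibreι 𝒴) η =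
          KZeroRat.map (specialFibreToTower 𝒴)
            (ContinuousKZeroRat.specialFibre (Ideal.span {(p : WittVector p κ)}) 𝒴 ξ)) :
    ∃ η : KZeroRat 𝒴.left,
        KZeroRat.map (WittScheme.specialFibreι 𝒴) η =
          KZeroRat.map (specialFibreToTower 𝒴)
            (ContinuousKZeroRat.specialFibre (Ideal.span {(p : WittVector p κ)}) 𝒴 (a • ξ)) := by
  obtain ⟨η, hη⟩ := hξ
  exact ⟨a • η, by rw [map_smul, map_smul, map_smul, hη]⟩

/-- **Algebraic pro-classes satisfy the conclusion of STUB P**: for `η ∈ K₀(𝒴)_ℚ` the pro-class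
`(η|_{X_n})_n` (`ContinuousKZeroRat.restrict`) is algebraized by `η` itself — the composite
`K₀(X) → lim_n K₀(X_n) → K₀(X₁)` of Bloch–Esnault–Kerz §1 (cf. `Crystalline.exists_lift_of_map_specialFibreι`).
[cite: BlochEsnaultKerz2014pAdic, §1] -/
theorem proClassAlgebraizes_restrict (η : KZeroRat 𝒴.left) :
    ∃ η' : KZeroRat 𝒴.left,
        KZeroRat.map (WittScheme.specialFibreι 𝒴) η' =
          KZeroRat.map (specialFibreToTower 𝒴)
            (ContinuousKZeroRat.specialFibre (Ideal.span {(p : WittVector p κ)}) 𝒴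
              (ContinuousKZeroRat.restrict (Ideal.span {(p : WittVector p κ)}) 𝒴 η)) :=
  ⟨η, by rw [ContinuousKZeroRat.proj_restrict, ← KZeroRat.map_comp_apply, specialFibreToTower_ι]⟩
end Linear

/-! ## §2 Effective pro-classes: compatible towers of vector bundles on the thickenings -/

section Effective
omit [CharP κ p] in
/-- **A compatible tower of vector bundles defines a pro-class.** If `E_n` is a vector bundle on
`X_n = 𝒴 ⊗ W/p^{n+1}` (`KTheory.thickening (p) 𝒴 n`) with `E_{n+1}|_{X_n} ≅ E_n` along the transition
closed immersions, then `([E_n])_n` is an element of `lim_n K₀(X_n)` (`KTheory.LimKZero`: isomorphic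
bundles have the same class, `KZero.of_iso`, and `[·]` commutes with pull-back, `KZero.map_of`).
[cite: BlochEsnaultKerz2014pAdic, §1 (the group `lim_n K₀(X_n)`)] [cite: Fulton1998, §15.1] -/
theorem exists_limKZero_of_tower
    (E : ∀ n : ℕ, (KTheory.thickening (Ideal.span {(p : WittVector p κ)}) 𝒴 n).Modules)
    (hE : ∀ n, IsFiniteLocallyFree (E n))
    (hc : ∀ n, Nonempty ((Scheme.Modules.pullback
      (thickeningTransition (Ideal.span {(p : WittVector p κ)}) 𝒴 n)).obj (E (n + 1)) ≅ E n)) :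
    ∃ x : LimKZero (Ideal.span {(p : WittVector p κ)}) 𝒴,
      ∀ n, LimKZero.proj (Ideal.span {(p : WittVector p κ)}) 𝒴 n x = KZero.of (E n) (hE n) := by
  refine ⟨⟨fun n => KZero.of (E n) (hE n), fun n => ?_⟩, fun n => rfl⟩
  rw [KZero.map_of]
  exact KZero.of_iso (hc n).some _ _

omit [CharP κ p] in
/-- The rational pro-class `ξ̂ = ([E_n])_n ⊗ 1 ∈ (lim_n K₀(X_n)) ⊗ ℚ` of a compatible tower of vector
bundles, with all its projections: `ξ̂|_{X_n} = [E_n]_ℚ`. [cite: BlochEsnaultKerz2014pAdic, §1 and Thm. 1.3 (b)] -/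
theorem exists_continuousKZeroRat_of_tower
    (E : ∀ n : ℕ, (KTheory.thickening (Ideal.span {(p : WittVector p κ)}) 𝒴 n).Modules)
    (hE : ∀ n, IsFiniteLocallyFree (E n))
    (hc : ∀ n, Nonempty ((Scheme.Modules.pullback
      (thickeningTransition (Ideal.span {(p : WittVector p κ)}) 𝒴 n)).obj (E (n + 1)) ≅ E n)) :
    ∃ ξ : ContinuousKZeroRat (Ideal.span {(p : WittVector p κ)}) 𝒴,
      ∀ n, ContinuousKZeroRat.proj (Ideal.span {(p : WittVector p κ)}) 𝒴 n ξ =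
        KZeroRat.of (E n) (hE n) := by
  obtain ⟨x, hx⟩ := exists_limKZero_of_tower 𝒴 E hE hc
  exact ⟨ContinuousKZeroRat.ofLimKZero (Ideal.span {(p : WittVector p κ)}) 𝒴 x, fun n => by
    rw [ContinuousKZeroRat.ofLimKZero_apply, ContinuousKZeroRat.proj_tmul, hx]; rfl⟩

/-- **The bottom bundle of a compatible tower LIFTS FORMALLY.** The tree's two `p`-adic thickening
towers are the same schemes — `KTheory.thickening (p) 𝒴 n = (WittScheme.thickening 𝒴 (n+1)).left`
(both `𝒴 ×_W Spec (W/p^{n+1})`), with the same transition maps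
(`thickeningTransition_eq_thickeningMap`) and the same embedding of `Y_κ`
(`Crystalline.specialFibreToTower 𝒴 = WittScheme.specialFibreToThickening 𝒴 0`) — so a compatible tower
`(E_n)_n` of vector bundles in the `KTheory` presentation is a formal lift, in the sense of
`WittScheme.LiftsFormally`, of its bottom bundle read on `Y_κ` ("lifts to the formal scheme",
Berthelot–Ogus 1983 Thm. 3.8; `ξ̂ ∈ lim K₀(X_n)` at the level of objects, Bloch–Esnault–Kerz §1).
[cite: BlochEsnaultKerz2014pAdic, §1] [cite: BerthelotOgus1983, Thm. 3.8] -/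
theorem liftsFormally_of_tower
    (E : ∀ n : ℕ, (KTheory.thickening (Ideal.span {(p : WittVector p κ)}) 𝒴 n).Modules)
    (hE : ∀ n, IsFiniteLocallyFree (E n))
    (hc : ∀ n, Nonempty ((Scheme.Modules.pullback
      (thickeningTransition (Ideal.span {(p : WittVector p κ)}) 𝒴 n)).obj (E (n + 1)) ≅ E n)) :
    WittScheme.LiftsFormally 𝒴
      ((Scheme.Modules.pullback (specialFibreToTower 𝒴)).obj (E 0)) := by
  refine ⟨fun n => E n, fun n => (hE n).isVectorBundle, fun n => ?_, ⟨Iso.refl _⟩⟩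
  obtain ⟨e⟩ := hc n
  exact ⟨((Scheme.Modules.pullbackCongr
    (thickeningTransition_eq_thickeningMap 𝒴 n)).app (E (n + 1))).symm ≪≫ e⟩
end Effective

/-! ## §3 The rung: STUB P on effective pro-classes, modulo Grothendieck's existence theorem -/

section Rung
omit [CharP κ p] in
/-- **A bundle on `Y_κ` that lifts to `𝒴` has its class in the range of `K₀(𝒴)_ℚ → K₀(Y_κ)_ℚ`**
(`[F]|_{Y_κ} = [F|_{Y_κ}] = [E₁]`). [cite: Fulton1998, §15.1] -/
theorem of_mem_range_map_specialFibreι_of_liftsTo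
    {E₁ : (WittScheme.specialFibre 𝒴).left.Modules} (hE₁ : IsFiniteLocallyFree E₁)
    (h : WittScheme.LiftsTo 𝒴 E₁) :
    KZeroRat.of E₁ hE₁ ∈ LinearMap.range (KZeroRat.map (WittScheme.specialFibreι 𝒴)) := by
  obtain ⟨F, hF, ⟨e⟩⟩ := h
  have hF' : IsFiniteLocallyFree F := Modules.isFiniteLocallyFree_of_isVectorBundle hF
  refine ⟨KZeroRat.of F hF', ?_⟩
  rw [KZeroRat.map_of]
  change (1 : ℚ) ⊗ₜ[ℤ] KZero.of _ _ = (1 : ℚ) ⊗ₜ[ℤ] KZero.of _ _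
  rw [KZero.of_iso e _ hE₁]

variable [PerfectRing κ p]

/-- **Grothendieck existence ⟹ the class of a formally lifting bundle algebraizes**: on a proper
`𝒴/W(κ)`, `κ` perfect, if `E₁` on `Y_κ` lifts to a compatible tower of vector bundles on the
thickenings, then `[E₁]_ℚ ∈ im(K₀(𝒴)_ℚ → K₀(Y_κ)_ℚ)` — the vector-bundle form of "Grothendieck's
formal existence theorem gives an algebraization isomorphism `Pic(X) ≅ lim_n Pic(X_n)`"
(Bloch–Esnault–Kerz §1 (1.3)), through the tree's `GrothendieckExistence_vectorBundle_witt`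
(Görtz–Wedhorn II Thm. 24.94 / Prop. 24.95, hypothesis `hGE`, NOT discharged).
[cite: BlochEsnaultKerz2014pAdic, §1 (1.3)] [cite: GortzWedhorn2023, Thm 24.94 and Prop 24.95]
[cite: EGAIII1, Thm 5.1.4] -/
theorem of_mem_range_map_specialFibreι_of_liftsFormally_of_grothendieckExistence
    (hGE : GrothendieckExistence_vectorBundle_witt.{0}) (h𝒴 : IsProper 𝒴.hom)
    {E₁ : (WittScheme.specialFibre 𝒴).left.Modules} (hE₁ : IsFiniteLocallyFree E₁)
    (h : WittScheme.LiftsFormally 𝒴 E₁) :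
    KZeroRat.of E₁ hE₁ ∈ LinearMap.range (KZeroRat.map (WittScheme.specialFibreι 𝒴)) :=
  of_mem_range_map_specialFibreι_of_liftsTo 𝒴 hE₁ (hGE.liftsTo_of_liftsFormally h𝒴 h)

/-- **THE RUNG — STUB P holds on effective pro-classes, modulo Grothendieck existence.** On a proper
`𝒴/W(κ)`, `κ` perfect of characteristic `p`: if the bottom class `ξ̂|_{X_0}` of a rational pro-class
`ξ̂ ∈ (lim_n K₀(𝒴 ⊗ W/p^{n+1})) ⊗ ℚ` is the class of the bottom bundle `E_0` of a compatible tower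
`(E_n)_n` of vector bundles on the thickenings, then `ProClassAlgebraizes 𝒴 ξ̂` (verbatim): `ξ̂|_{Y_κ}`
is the restriction of an algebraic class `η ∈ K₀(𝒴)_ℚ` — namely `η = [F]` for the algebraization `F` of
the tower (EGA III₁ 5.1.4). The line-bundle case is Bloch–Esnault–Kerz §1 (1.1)–(1.3); the open part of
the bet (AMMN Conj. 1.3 / BEK Conj. 1.2) is thereby the NON-effective pro-classes (BEK §1 Remark (iii)).
[cite: BlochEsnaultKerz2014pAdic, §1 (1.3), Conj. 1.2, Remark (iii)]
[cite: AntieauMathewMorrowNikolaus2022, Conj. 1.3] [cite: GortzWedhorn2023, Prop 24.95] -/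
theorem proClassAlgebraizes_of_tower_of_grothendieckExistence
    (hGE : GrothendieckExistence_vectorBundle_witt.{0}) (h𝒴 : IsProper 𝒴.hom)
    (E : ∀ n : ℕ, (KTheory.thickening (Ideal.span {(p : WittVector p κ)}) 𝒴 n).Modules)
    (hE : ∀ n, IsFiniteLocallyFree (E n))
    (hc : ∀ n, Nonempty ((Scheme.Modules.pullback
      (thickeningTransition (Ideal.span {(p : WittVector p κ)}) 𝒴 n)).obj (E (n + 1)) ≅ E n))
    (ξ : ContinuousKZeroRat (Ideal.span {(p : WittVector p κ)}) 𝒴)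
    (hξ : ContinuousKZeroRat.specialFibre (Ideal.span {(p : WittVector p κ)}) 𝒴 ξ =
      KZeroRat.of (E 0) (hE 0)) :
    ∃ η : KZeroRat 𝒴.left,
        KZeroRat.map (WittScheme.specialFibreι 𝒴) η =
          KZeroRat.map (specialFibreToTower 𝒴)
            (ContinuousKZeroRat.specialFibre (Ideal.span {(p : WittVector p κ)}) 𝒴 ξ) := by
  rw [proClassAlgebraizes_iff_specialFibre_mem_range, hξ, KZeroRat.map_of]
  exact of_mem_range_map_specialFibreι_of_liftsFormally_of_grothendieckExistence 𝒴 hGE h𝒴 _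
    (liftsFormally_of_tower 𝒴 E hE hc)

/-- **`ℚ`-span form of the rung.** On a proper `𝒴/W(κ)`, `κ` perfect, modulo Grothendieck existence:
STUB P holds for every rational pro-class `ξ̂` whose bottom class `ξ̂|_{X_0}` lies in the `ℚ`-span of
the bottom classes `[E_0]_ℚ` of compatible towers of vector bundles (so for all formal differences of
effective towers). [cite: BlochEsnaultKerz2014pAdic, §1 (1.3) and Remark (iii)]
[cite: GortzWedhorn2023, Prop 24.95] -/
theorem proClassAlgebraizes_of_mem_span_effective_of_grothendieckExistence
    (hGE : GrothendieckExistence_vectorBundle_witt.{0}) (h𝒴 : IsProper 𝒴.hom)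
    (ξ : ContinuousKZeroRat (Ideal.span {(p : WittVector p κ)}) 𝒴)
    (hξ : ContinuousKZeroRat.specialFibre (Ideal.span {(p : WittVector p κ)}) 𝒴 ξ ∈
      Submodule.span ℚ
        {c : KZeroRat (KTheory.thickening (Ideal.span {(p : WittVector p κ)}) 𝒴 0) |
          ∃ (E : ∀ n : ℕ, (KTheory.thickening (Ideal.span {(p : WittVector p κ)}) 𝒴 n).Modules)
            (hE : ∀ n, IsFiniteLocallyFree (E n)),
            (∀ n, Nonempty ((Scheme.Modules.pullback
              (thickeningTransition (Ideal.span {(p : WittVector p κ)}) 𝒴 n)).obj (E (n + 1)) ≅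
                E n)) ∧
            c = KZeroRat.of (E 0) (hE 0)}) :
    ∃ η : KZeroRat 𝒴.left,
        KZeroRat.map (WittScheme.specialFibreι 𝒴) η =
          KZeroRat.map (specialFibreToTower 𝒴)
            (ContinuousKZeroRat.specialFibre (Ideal.span {(p : WittVector p κ)}) 𝒴 ξ) := by
  rw [proClassAlgebraizes_iff_specialFibre_mem_range]
  have hle : Submodule.span ℚ
      {c : KZeroRat (KTheory.thickening (Ideal.span {(p : WittVector p κ)}) 𝒴 0) |
        ∃ (E : ∀ n : ℕ, (KTheory.thickening (Ideal.span {(p : WittVector p κ)}) 𝒴 n).Modules)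
          (hE : ∀ n, IsFiniteLocallyFree (E n)),
          (∀ n, Nonempty ((Scheme.Modules.pullback
            (thickeningTransition (Ideal.span {(p : WittVector p κ)}) 𝒴 n)).obj (E (n + 1)) ≅
              E n)) ∧
          c = KZeroRat.of (E 0) (hE 0)} ≤
      Submodule.comap (KZeroRat.map (specialFibreToTower 𝒴))
        (LinearMap.range (KZeroRat.map (WittScheme.specialFibreι 𝒴))) := by
    refine Submodule.span_le.mpr ?_
    rintro c ⟨E, hE, hc, rfl⟩
    rw [SetLike.mem_coe, Submodule.mem_comap, KZeroRat.map_of]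
    exact of_mem_range_map_specialFibreι_of_liftsFormally_of_grothendieckExistence 𝒴 hGE h𝒴 _
      (liftsFormally_of_tower 𝒴 E hE hc)
  exact hle hξ

/-- **STUB P with ONE extra binder — effectivity of `ξ̂|_{X_0}` — follows from Grothendieck's
existence theorem** (the bet's quantifier block verbatim: `∀ d ∃ p₀ ∀ p ≥ p₀ ∀ κ … ∀ 𝒴 smooth proper
model ∀ ξ̂`, here with `p₀ = 0` and only properness of `𝒴` used).
[cite: BlochEsnaultKerz2014pAdic, §1 (1.3) and Conj. 1.2] [cite: AntieauMathewMorrowNikolaus2022, Conj. 1.3]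
[cite: GortzWedhorn2023, Thm 24.94 and Prop 24.95] -/
theorem padicImageAlgebraization_effective_of_grothendieckExistence
    (hGE : GrothendieckExistence_vectorBundle_witt.{0}) :
    ∀ d : ℕ, ∃ p₀ : ℕ, ∀ (p : ℕ) [Fact p.Prime], p₀ ≤ p →
    ∀ (κ : Type) [Field κ] [CharP κ p] [PerfectRing κ p] [IsAlgClosed κ] [Algebra (ZMod p) κ],
    Algebra.IsAlgebraic (ZMod p) κ →
    ∀ (𝒴 : SchemeOver (WittVector p κ)), WittScheme.IsSmoothProperModel d 𝒴 →
    ∀ ξ : ContinuousKZeroRat (Ideal.span {(p : WittVector p κ)}) 𝒴,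
    (∃ (E : ∀ n : ℕ, (KTheory.thickening (Ideal.span {(p : WittVector p κ)}) 𝒴 n).Modules)
        (hE : ∀ n, IsFiniteLocallyFree (E n)),
        (∀ n, Nonempty ((Scheme.Modules.pullback
          (thickeningTransition (Ideal.span {(p : WittVector p κ)}) 𝒴 n)).obj (E (n + 1)) ≅ E n)) ∧
        ContinuousKZeroRat.specialFibre (Ideal.span {(p : WittVector p κ)}) 𝒴 ξ =
          KZeroRat.of (E 0) (hE 0)) →
    ∃ η : KZeroRat 𝒴.left,
      KZeroRat.map (WittScheme.specialFibreι 𝒴) η =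
        KZeroRat.map (specialFibreToTower 𝒴)
          (ContinuousKZeroRat.specialFibre (Ideal.span {(p : WittVector p κ)}) 𝒴 ξ) := by
  intro d
  refine ⟨0, ?_⟩
  intro p _ _ κ _ _ _ _ _ _ 𝒴 h𝒴 ξ hξ
  obtain ⟨E, hE, hc, hξ⟩ := hξ
  exact proClassAlgebraizes_of_tower_of_grothendieckExistence 𝒴 hGE h𝒴.isProper E hE hc ξ hξ
end Rung

/-! ## §4 Junction with route `PadicSemiregularLift` at STUB P -/

section Junction
variable [PerfectRing κ p]

/-- **Route `PadicSemiregularLift`'s item `FormalVectorBundlesAlgebraize` (stmt-HodgeConjecture-14106: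
`LiftsFormally ⟹ LiftsTo` on smooth proper models) proves STUB P on effective pro-classes over smooth
proper models** — the junction of the two routes at the bet, as a kernel edge.
[cite: BlochEsnaultKerz2014pAdic, §1 (1.3)] [cite: GortzWedhorn2023, Prop 24.95] -/
theorem proClassAlgebraizes_of_tower_of_formalVectorBundlesAlgebraize
    (hFVB : Theses.PadicSemiregularLift.FormalVectorBundlesAlgebraize) {d : ℕ}
    (h𝒴 : WittScheme.IsSmoothProperModel d 𝒴)
    (E : ∀ n : ℕ, (KTheory.thickening (Ideal.span {(p : WittVector p κ)}) 𝒴 n).Modules)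
    (hE : ∀ n, IsFiniteLocallyFree (E n))
    (hc : ∀ n, Nonempty ((Scheme.Modules.pullback
      (thickeningTransition (Ideal.span {(p : WittVector p κ)}) 𝒴 n)).obj (E (n + 1)) ≅ E n))
    (ξ : ContinuousKZeroRat (Ideal.span {(p : WittVector p κ)}) 𝒴)
    (hξ : ContinuousKZeroRat.specialFibre (Ideal.span {(p : WittVector p κ)}) 𝒴 ξ =
      KZeroRat.of (E 0) (hE 0)) :
    ∃ η : KZeroRat 𝒴.left,
        KZeroRat.map (WittScheme.specialFibreι 𝒴) η =
          KZeroRat.map (specialFibreToTower 𝒴)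
            (ContinuousKZeroRat.specialFibre (Ideal.span {(p : WittVector p κ)}) 𝒴 ξ) := by
  rw [proClassAlgebraizes_iff_specialFibre_mem_range, hξ, KZeroRat.map_of]
  exact of_mem_range_map_specialFibreι_of_liftsTo 𝒴 _
    (hFVB p κ d 𝒴 h𝒴 _ (liftsFormally_of_tower 𝒴 E hE hc))

/-- **STUB P with the effectivity binder, from route `PadicSemiregularLift`'s `FormalVectorBundlesAlgebraize`**
(the bet's quantifier block verbatim, `p₀ = 0`): "junction with route `PadicSemiregularLift`, whose
engine … `FormalVectorBundlesAlgebraize` is one way to prove STUB P" (skeleton, module docstring) —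
for effective pro-classes that engine alone suffices.
[cite: BlochEsnaultKerz2014pAdic, §1 (1.3) and Conj. 1.2] [cite: AntieauMathewMorrowNikolaus2022, Conj. 1.3] -/
theorem padicImageAlgebraization_effective_of_formalVectorBundlesAlgebraize
    (hFVB : Theses.PadicSemiregularLift.FormalVectorBundlesAlgebraize) :
    ∀ d : ℕ, ∃ p₀ : ℕ, ∀ (p : ℕ) [Fact p.Prime], p₀ ≤ p →
    ∀ (κ : Type) [Field κ] [CharP κ p] [PerfectRing κ p] [IsAlgClosed κ] [Algebra (ZMod p) κ],
    Algebra.IsAlgebraic (ZMod p) κ →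
    ∀ (𝒴 : SchemeOver (WittVector p κ)), WittScheme.IsSmoothProperModel d 𝒴 →
    ∀ ξ : ContinuousKZeroRat (Ideal.span {(p : WittVector p κ)}) 𝒴,
    (∃ (E : ∀ n : ℕ, (KTheory.thickening (Ideal.span {(p : WittVector p κ)}) 𝒴 n).Modules)
        (hE : ∀ n, IsFiniteLocallyFree (E n)),
        (∀ n, Nonempty ((Scheme.Modules.pullback
          (thickeningTransition (Ideal.span {(p : WittVector p κ)}) 𝒴 n)).obj (E (n + 1)) ≅ E n)) ∧
        ContinuousKZeroRat.specialFibre (Ideal.span {(p : WittVector p κ)}) 𝒴 ξ =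
          KZeroRat.of (E 0) (hE 0)) →
    ∃ η : KZeroRat 𝒴.left,
      KZeroRat.map (WittScheme.specialFibreι 𝒴) η =
        KZeroRat.map (specialFibreToTower 𝒴)
          (ContinuousKZeroRat.specialFibre (Ideal.span {(p : WittVector p κ)}) 𝒴 ξ) := by
  intro d
  refine ⟨0, ?_⟩
  intro p _ _ κ _ _ _ _ _ _ 𝒴 h𝒴 ξ hξ
  obtain ⟨E, hE, hc, hξ⟩ := hξ
  exact proClassAlgebraizes_of_tower_of_formalVectorBundlesAlgebraize 𝒴 hFVB h𝒴 E hE hc ξ hξ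
end Junction

end Summit.HodgeConjecture.HodgeConjecture.Theorems

end
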